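/-
Origin: expansion seat `planner-pub-hodgecm-pv14-g5-0`, handover #4 2026-08-18T09:56:21Z (`HOME/pub-hodgecm-pv14-g5/lean/Pv14g5/SchwartzModulation.lean`, md5 81033b1b, 218 lines);
landed by the gen-7 packager in gate run 28 as `HodgeCM/Automorphic/SchwartzModulation.lean` (import ^import Pv14g5\.→import HodgeCM.Automorphic. ×1; import ^import Pv14g4\.→import HodgeCM.Automorphic. ×1).
-/
/-
Origin: HOME/pub-hodgecm-pv14-g5/lean/Pv14g5/SchwartzModulation.lean — session planner-pub-hodgecm-pv14-g5-0
(unit pub-hodgecm-pv14-g5, DAG-node prover #14 gen 5).  Intended final place: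
`HodgeCM/Automorphic/SchwartzModulation.lean` (namespace `HodgeCM.SchwartzWeil`).
PACKAGER: rewrite `import Pv14g4.SchwartzTranslation` to `import HodgeCM.Automorphic.SchwartzTranslation`
(pv14-g4 HANDOVER #1, t27) and `import Pv14g5.PoissonSummationLattice` to
`import HodgeCM.Automorphic.PoissonSummationLattice` (this seat's HANDOVER #1); Mathlib otherwise.
Asserts nothing (no `axiom`, no new constants).
-/
import Summits.HodgeConjecture.HodgeCM.Automorphic.SchwartzTranslation
import Summits.HodgeConjecture.HodgeCM.Automorphic.PoissonSummationLattice_2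

/-!
# Heisenberg modulations on the Schwartz space, as the Fourier conjugates of translations

GAPS `pv14g4-K1`, obstruction (a): to adjoin Weil's Weyl element `d'(γ)` (the Fourier transform) to the
Schrödinger–lattice model one needs the second half of the Heisenberg group — the MODULATIONS
`M_b Φ = 𝐞⟪b, ·⟫ · Φ` — as continuous operators of `𝓢(V, ℂ)`, jointly continuous in `(b, Φ)`, together with
the commutation relation with the translations `τ_a Φ = Φ(· - a)` and the fact that `𝓕` exchanges the two.

This file supplies exactly that, as KERNEL theorems, by DEFINING the modulation as the Fourier conjugate of
pv14-g4's translation operator,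
  `modCLM V b := 𝓕⁻ ∘L τ_b ∘L 𝓕 : 𝓢(V, ℂ) →L[ℂ] 𝓢(V, ℂ)`,
and COMPUTING it: `modCLM_apply : modCLM V b Φ x = 𝐞 ⟪b, x⟫ * Φ x` (Mathlib's
`VectorFourier.fourierIntegral_comp_add_right` + Fourier inversion on `𝓢`).  Consequences:

* `fourier_modCLM : 𝓕 (M_b Φ) = τ_b (𝓕 Φ)` and `fourier_compSubConstCLM : 𝓕 (τ_a Φ) = M_{-a} (𝓕 Φ)` — the Weyl
  element normalises the Heisenberg group, swapping its two halves [We64 n° 5–6, `d'(γ)`];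
* `compSubConstCLM_comp_modCLM : τ_a ∘ M_b = 𝐞(-⟪b, a⟫) • (M_b ∘ τ_a)` — the Heisenberg commutation relation;
* `modCLM_zero`, `modCLM_add` (a representation of `V`), `norm_modCLM_apply` (unitarity pointwise);
* `continuous_modCLM_uncurry : (b, Φ) ↦ M_b Φ` is JOINTLY continuous `V × 𝓢(V, ℂ) → 𝓢(V, ℂ)` — immediate from
  pv14-g4's joint continuity of translation and the continuity of `𝓕`, `𝓕⁻` on `𝓢`; no seminorm estimate needed;
* `thetaCLM_modCLM_of_mem_dualLattice : Θ_L(M_b Φ)(x) = 𝐞⟪b, x⟫ Θ_L(Φ)(x)` for `b` in the DUAL lattice `L*` — so the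
  theta distribution `Θ_L(·)(0)` is invariant under the arithmetic modulations `b ∈ L*`, the second half of Weil's
  `r_k(Ps_k)`.

LABELS.  KERNEL throughout (Mathlib + pv14-g4 #1 + this seat's #1).  Not here: the central extension / metaplectic
cocycle making `(a, b, u)` a group acting through `u^m M_b τ_a` (next leaf), finite places.  No PerL / QW8 / 2001
statement is used.
-/

set_option autoImplicit false

noncomputable section

open MeasureTheory
open scoped RealInnerProductSpace FourierTransform SchwartzMap

namespace HodgeCM
namespace SchwartzWeil

variable (V : Type*) [NormedAddCommGroup V] [InnerProductSpace ℝ V] [FiniteDimensional ℝ V]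
  [MeasurableSpace V] [BorelSpace V]

/-! ## 1. Translation ↔ phase under the Fourier integral (Mathlib, restated pointwise over `ℂ`) -/

/-- `𝓕 (f ∘ (· + v₀)) (w) = 𝐞⟪v₀, w⟫ • 𝓕 f (w)` (`VectorFourier.fourierIntegral_comp_add_right` for `innerₗ V`). -/
theorem fourier_comp_add_right_apply' (f : V → ℂ) (v₀ w : V) :
    𝓕 (f ∘ fun v => v + v₀) w = 𝐞 ⟪v₀, w⟫ • 𝓕 f w :=
  congrFun (VectorFourier.fourierIntegral_comp_add_right 𝐞 volume (innerₗ V) f v₀) w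

/-- `𝓕 (f ∘ (· + v₀)) (w) = 𝐞⟪v₀, w⟫ · 𝓕 f (w)`, with the phase coerced into `ℂ`. -/
theorem fourier_comp_add_right_apply (f : V → ℂ) (v₀ w : V) :
    𝓕 (f ∘ fun v => v + v₀) w = (𝐞 ⟪v₀, w⟫ : ℂ) * 𝓕 f w := by
  rw [fourier_comp_add_right_apply', Circle.smul_def, smul_eq_mul]

omit [InnerProductSpace ℝ V] [FiniteDimensional ℝ V] [MeasurableSpace V] [BorelSpace V] in
/-- The translation operator as a precomposition: `⇑(τ_a f) = ⇑f ∘ (· + (-a))`. -/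
theorem coe_compSubConstCLM_eq_comp [NormedSpace ℝ V] (a : V) (f : 𝓢(V, ℂ)) :
    ⇑(SchwartzMap.compSubConstCLM ℂ a f) = ⇑f ∘ fun v => v + -a := by
  funext z
  simp only [SchwartzMap.compSubConstCLM_apply, Function.comp_apply, ← sub_eq_add_neg]

/-! ## 2. The modulation operators `M_b = 𝓕⁻ ∘ τ_b ∘ 𝓕` -/

/-- **Heisenberg modulation** `M_b : 𝓢(V, ℂ) →L[ℂ] 𝓢(V, ℂ)`, DEFINED as the Fourier conjugate `𝓕⁻ ∘ τ_b ∘ 𝓕` of the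
translation `τ_b f = f (· - b)`; `modCLM_apply` computes it as `Φ ↦ 𝐞⟪b, ·⟫ · Φ`. -/
def modCLM (b : V) : 𝓢(V, ℂ) →L[ℂ] 𝓢(V, ℂ) :=
  (FourierTransform.fourierInvCLM ℂ 𝓢(V, ℂ)).comp
    ((SchwartzMap.compSubConstCLM ℂ b).comp (FourierTransform.fourierCLM ℂ 𝓢(V, ℂ)))

/-- (Ported verbatim from the HodgeCMPerL package; no docstring in the source.) -/
theorem modCLM_eq (b : V) (Φ : 𝓢(V, ℂ)) :
    modCLM V b Φ = 𝓕⁻ (SchwartzMap.compSubConstCLM ℂ b (𝓕 Φ)) := rfl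

/-- **`(M_b Φ)(x) = 𝐞⟪b, x⟫ · Φ(x)`.** -/
@[simp] theorem modCLM_apply (b : V) (Φ : 𝓢(V, ℂ)) (x : V) :
    modCLM V b Φ x = (𝐞 ⟪b, x⟫ : ℂ) * Φ x := by
  rw [modCLM_eq, SchwartzMap.fourierInv_coe, Real.fourierInv_eq_fourier_neg, coe_compSubConstCLM_eq_comp,
    fourier_comp_add_right_apply, inner_neg_neg, ← Real.fourierInv_eq_fourier_neg, ← SchwartzMap.fourierInv_coe,
    FourierTransform.fourierInv_fourier_eq]

/-- (Ported verbatim from the HodgeCMPerL package; no docstring in the source.) -/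
theorem coe_modCLM (b : V) (Φ : 𝓢(V, ℂ)) : ⇑(modCLM V b Φ) = fun x => (𝐞 ⟪b, x⟫ : ℂ) * Φ x :=
  funext (modCLM_apply V b Φ)

/-- `|M_b Φ| = |Φ|` pointwise (the modulation is unitary on `L²`, isometric for every sup-seminorm of order 0). -/
theorem norm_modCLM_apply (b : V) (Φ : 𝓢(V, ℂ)) (x : V) : ‖modCLM V b Φ x‖ = ‖Φ x‖ := by
  rw [modCLM_apply, norm_mul, Circle.norm_coe, one_mul]

/-- `M_0 = id`. -/
theorem modCLM_zero : modCLM V 0 = ContinuousLinearMap.id ℂ 𝓢(V, ℂ) := by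
  ext Φ x
  simp only [modCLM_apply, inner_zero_left, AddChar.map_zero_eq_one, Circle.coe_one, one_mul,
    ContinuousLinearMap.coe_id', id_eq]

/-- `M_{b + c} = M_b ∘ M_c`: the modulations form a representation of the additive group `V`. -/
theorem modCLM_add (b c : V) : modCLM V (b + c) = (modCLM V b).comp (modCLM V c) := by
  ext Φ x
  simp only [ContinuousLinearMap.comp_apply, modCLM_apply, inner_add_left, AddChar.map_add_eq_mul,
    Circle.coe_mul, mul_assoc]

/-- (Ported verbatim from the HodgeCMPerL package; no docstring in the source.) -/
theorem modCLM_comm (b c : V) : (modCLM V b).comp (modCLM V c) = (modCLM V c).comp (modCLM V b) := by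
  rw [← modCLM_add, ← modCLM_add, add_comm]

/-! ## 3. The Weyl element swaps translations and modulations -/

/-- **`𝓕 ∘ M_b = τ_b ∘ 𝓕`**: `𝓕 (M_b Φ) = (𝓕 Φ)(· - b)`. -/
theorem fourier_modCLM (b : V) (Φ : 𝓢(V, ℂ)) :
    𝓕 (modCLM V b Φ) = SchwartzMap.compSubConstCLM ℂ b (𝓕 Φ) := by
  rw [modCLM_eq, FourierTransform.fourier_fourierInv_eq]

/-- **`𝓕 ∘ τ_a = M_{-a} ∘ 𝓕`**: `𝓕 (Φ(· - a)) = 𝐞(-⟪a, ·⟫) · 𝓕 Φ`. -/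
theorem fourier_compSubConstCLM (a : V) (Φ : 𝓢(V, ℂ)) :
    𝓕 (SchwartzMap.compSubConstCLM ℂ a Φ) = modCLM V (-a) (𝓕 Φ) := by
  ext w
  rw [modCLM_apply, SchwartzMap.fourier_coe, coe_compSubConstCLM_eq_comp, fourier_comp_add_right_apply,
    SchwartzMap.fourier_coe]

/-- `𝓕⁻ ∘ τ_b = M_b ∘ 𝓕⁻`. -/
theorem fourierInv_compSubConstCLM (b : V) (Ψ : 𝓢(V, ℂ)) :
    𝓕⁻ (SchwartzMap.compSubConstCLM ℂ b Ψ) = modCLM V b (𝓕⁻ Ψ) := by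
  rw [modCLM_eq, FourierTransform.fourier_fourierInv_eq]

/-- `𝓕⁻ ∘ M_a = τ_{-a} ∘ 𝓕⁻`, equivalently `M_a = 𝓕 ∘ τ_{-a} ∘ 𝓕⁻`. -/
theorem fourierInv_modCLM (a : V) (Ψ : 𝓢(V, ℂ)) :
    𝓕⁻ (modCLM V a Ψ) = SchwartzMap.compSubConstCLM ℂ (-a) (𝓕⁻ Ψ) := by
  have h := fourier_compSubConstCLM V (-a) (𝓕⁻ Ψ)
  rw [neg_neg, FourierTransform.fourier_fourierInv_eq] at h
  rw [← h, FourierTransform.fourierInv_fourier_eq]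

/-! ## 4. The Heisenberg commutation relation -/

/-- **`τ_a ∘ M_b = 𝐞(-⟪b, a⟫) • (M_b ∘ τ_a)`** on `𝓢(V, ℂ)`. -/
theorem compSubConstCLM_comp_modCLM (a b : V) :
    (SchwartzMap.compSubConstCLM ℂ a).comp (modCLM V b) =
      ((𝐞 (-⟪b, a⟫) : Circle) : ℂ) • ((modCLM V b).comp (SchwartzMap.compSubConstCLM ℂ a)) := by
  ext Φ x
  simp only [ContinuousLinearMap.comp_apply, smul_apply, smul_eq_mul, SchwartzMap.compSubConstCLM_apply,
    modCLM_apply]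
  rw [inner_sub_right, sub_eq_add_neg, AddChar.map_add_eq_mul, Circle.coe_mul]
  ring

/-- Pointwise form: `(M_b Φ)(x - a) = 𝐞(-⟪b, a⟫) · 𝐞⟪b, x⟫ · Φ(x - a)`. -/
theorem modCLM_apply_sub (a b : V) (Φ : 𝓢(V, ℂ)) (x : V) :
    modCLM V b Φ (x - a) = (𝐞 (-⟪b, a⟫) : ℂ) * ((𝐞 ⟪b, x⟫ : ℂ) * Φ (x - a)) := by
  rw [modCLM_apply, inner_sub_right, sub_eq_add_neg, AddChar.map_add_eq_mul, Circle.coe_mul]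
  ring

/-! ## 5. Joint continuity of `(b, Φ) ↦ M_b Φ` -/

/-- **Joint continuity of modulation on the Schwartz space** (the modulation half of We64 n° 39 in the Schrödinger
model): `(b, Φ) ↦ M_b Φ` is continuous `V × 𝓢(V, ℂ) → 𝓢(V, ℂ)` — by conjugating pv14-g4's joint continuity of
translation with the homeomorphisms `𝓕`, `𝓕⁻` of `𝓢(V, ℂ)`. -/
theorem continuous_modCLM_uncurry : Continuous fun p : V × 𝓢(V, ℂ) => modCLM V p.1 p.2 := by
  have h0 : Continuous fun p : V × 𝓢(V, ℂ) => ((p.1, 𝓕 p.2) : V × 𝓢(V, ℂ)) :=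
    continuous_fst.prodMk ((FourierTransform.continuous_fourier (E := 𝓢(V, ℂ))).comp continuous_snd)
  have h1 : Continuous fun p : V × 𝓢(V, ℂ) => SchwartzMap.compSubConstCLM ℂ p.1 (𝓕 p.2) :=
    (continuous_compSubConstCLM_uncurry ℂ (E := V) (F := ℂ)).comp h0
  have h2 : Continuous fun p : V × 𝓢(V, ℂ) => (𝓕⁻ (SchwartzMap.compSubConstCLM ℂ p.1 (𝓕 p.2)) : 𝓢(V, ℂ)) :=
    (FourierTransform.continuous_fourierInv (E := 𝓢(V, ℂ))).comp h1
  simp only [modCLM_eq]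
  exact h2

/-- Strong continuity: for fixed `Φ`, `b ↦ M_b Φ` is continuous `V → 𝓢(V, ℂ)`. -/
theorem continuous_modCLM_left (Φ : 𝓢(V, ℂ)) : Continuous fun b : V => modCLM V b Φ := by
  -- NB: term-mode `(continuous_modCLM_uncurry V).comp (Continuous.prodMk_left Φ)` against the expected type makes
  -- the unifier unfold `modCLM` (a deep tower of `mkCLM`s) and time out; rewrite the composite syntactically instead.
  have h := (continuous_modCLM_uncurry V).comp (Continuous.prodMk_left Φ)
  dsimp only [Function.comp_def] at h
  exact h

/-! ## 6. Arithmetic modulations: `b ∈ L*` and the theta distribution -/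

variable (L : Submodule ℤ V) [DiscreteTopology L]

omit [FiniteDimensional ℝ V] [MeasurableSpace V] [BorelSpace V] [DiscreteTopology L] in
/-- For `b ∈ L*` and `v ∈ L`, `𝐞⟪b, v⟫ = 1`. -/
theorem fourierChar_inner_eq_one_of_mem_dualLattice {b : V} (hb : b ∈ PoissonSummation.dualLattice L) (v : L) :
    𝐞 ⟪b, (v : V)⟫ = 1 := by
  obtain ⟨n, hn⟩ := PoissonSummation.mem_dualLattice.mp hb v v.2
  rw [← hn, PoissonSummation.fourierChar_intCast]

/-- **`Θ_L(M_b Φ)(x) = 𝐞⟪b, x⟫ · Θ_L(Φ)(x)` for `b ∈ L*`**: on the theta distribution of `L` the arithmetic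
modulations act through a phase; in particular `Θ_L(M_b Φ)(0) = Θ_L(Φ)(0)`
(`thetaCLM_zero_modCLM_of_mem_dualLattice`). -/
theorem thetaCLM_modCLM_of_mem_dualLattice {b : V} (hb : b ∈ PoissonSummation.dualLattice L) (Φ : 𝓢(V, ℂ))
    (x : V) : thetaCLM L x (modCLM V b Φ) = (𝐞 ⟪b, x⟫ : ℂ) * thetaCLM L x Φ := by
  simp only [thetaCLM_apply, modCLM_apply]
  rw [← tsum_mul_left]
  refine tsum_congr fun v => ?_
  rw [inner_add_right, AddChar.map_add_eq_mul, fourierChar_inner_eq_one_of_mem_dualLattice V L hb v, mul_one]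

/-- `Θ_L(M_b Φ)(0) = Θ_L(Φ)(0)` for `b ∈ L*`: the theta distribution `Σ_{v ∈ L} δ_v` is invariant under the
arithmetic modulations (the `X_k*`-half of Weil's `r_k(Ps_k)`). -/
theorem thetaCLM_zero_modCLM_of_mem_dualLattice {b : V} (hb : b ∈ PoissonSummation.dualLattice L)
    (Φ : 𝓢(V, ℂ)) : thetaCLM L (0 : V) (modCLM V b Φ) = thetaCLM L (0 : V) Φ := by
  rw [thetaCLM_modCLM_of_mem_dualLattice V L hb, inner_zero_right, AddChar.map_zero_eq_one, Circle.coe_one,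
    one_mul]

/-- At lattice points the phase is also trivial: `Θ_L(M_b Φ)(v) = Θ_L(Φ)(v)` for `b ∈ L*`, `v ∈ L`. -/
theorem thetaCLM_coe_modCLM_of_mem_dualLattice {b : V} (hb : b ∈ PoissonSummation.dualLattice L)
    (Φ : 𝓢(V, ℂ)) (v : L) : thetaCLM L (v : V) (modCLM V b Φ) = thetaCLM L (v : V) Φ := by
  rw [thetaCLM_modCLM_of_mem_dualLattice V L hb, fourierChar_inner_eq_one_of_mem_dualLattice V L hb v,
    Circle.coe_one, one_mul]

end SchwartzWeil
end HodgeCM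

end
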